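import Literature.Geometry.Symplectic.SteinPALF
import HarnessLib

/-!
# Wendl 2010, Thm. 1 for compact Stein domains: a planar supporting open book on the boundary
# of a Stein domain bounds a planar positive allowable Lefschetz fibration (named fact)

Topic `Literature/Geometry/Symplectic`.  ONE named fact, no proofs, over the tree's fibration
vocabulary `PALF` (`SteinPALF.lean`, which defers *"the existence theorems (Akbulut–Ozbagci 2001,
Thm. 1; Loi–Piergallini 2001; Wendl 2010, Thm. 1) — named facts filed by their consumers over
this vocabulary"*).

C. Wendl, *Strongly fillable contact manifolds and `J`-holomorphic foliations*, Duke Math. J.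
151 (2010) 337–384 (= arXiv:0806.3193), **Theorem 1** (p. 4 of the arXiv text): "Suppose
`(W, ω)` is a strong symplectic filling of a contact 3-manifold `(M, ξ)` supported by a planar
open book `π : M \ B → S¹`.  Then `(W, ω)` admits a symplectic Lefschetz fibration over the disc
whose boundary restricts to `π`, and which is allowable if `(W, ω)` is minimal."  With the proof
of Cor. 1 (p. 5: Stein = exact fillings are minimal, so no blow-up occurs) this is the form
used by T. Oba, Geom. Dedicata 183 (2016), **Thm. 1.3**: "a Stein filling of a contact
3-manifold supported by a planar open book admits a PALF whose boundary open book is the given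
one".

The statement below renders it for compact connected Stein domains `(W, S)` with boundary datum
`b`: if an open book `K` of `b.carrier ≅ ∂W` is planar and supports the complex tangencies
`ξ_J = boundaryPlaneField S.J b`, then `W` carries a `PALF S.complexOrientation b` whose boundary
open book has planar pages and binding homeomorphic to that of `K`.  It is, character for
character, the hypothesis `hW` of the ACCEPTED theorems `Oba2016_handleCount_of_wendl_of_kas`,
`Oba2016_steinFilling_twoTubes_of_wendl_of_kas` and
`Oba2016_steinFilling_fourHoledSphere_of_wendl_of_kas_of_cancel`
(`PlanarHomologySphereFillingsPALF.lean`, p154503), vendored as a named fact at the request of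
promote event 4335855 (provefact unit of `Oba2016_steinFilling_fourHoledSphere`; librarian sweep
g40, 2026-08-17), together with its sibling `Kas1980_planarPALF_handleCount`
(`PlanarPALFHandleCount.lean`).  Triage XL (compactness of `J`-holomorphic foliations).
Deliberately NOT here: strong (non-Stein) fillings, the identification of the boundary open book
beyond planarity of pages and the homeomorphism type of the binding, any proof.

## References

* C. Wendl, Duke Math. J. 151 (2010) 337–384, doi:10.1215/00127094-2010-001; arXiv:0806.3193:
  Thm. 1 (p. 4), proof of Cor. 1 (p. 5). [Wendl2010]
* T. Oba, *Stein fillings of homology 3-spheres and mapping class groups*, Geom. Dedicata 183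
  (2016); arXiv:1407.5257: Thm. 1.3. [Oba2016]
-/

noncomputable section

open Set Function
open scoped Manifold ContDiff Topology

namespace Literature.Geometry.Symplectic

open Literature.Topology.FourManifolds

/-- **Wendl 2010, Thm. 1 (compact Stein domains; Oba 2016, Thm. 1.3).**  A compact connected Stein
domain `(W, S)` whose boundary complex tangencies `boundaryPlaneField S.J b` are supported by a
planar open book `K` of `b.carrier` carries a positive allowable Lefschetz fibration
`P : PALF S.complexOrientation b` whose boundary open book has planar pages and whose binding is
homeomorphic to the binding of `K` ("admits a symplectic Lefschetz fibration over the disc whose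
boundary restricts to `π`, and which is allowable if `(W, ω)` is minimal"; Stein fillings are
minimal, proof of Cor. 1).  Verbatim the hypothesis `hW` of
`Oba2016_steinFilling_fourHoledSphere_of_wendl_of_kas_of_cancel`.
[cite: Wendl2010, Thm. 1 (p. 4 of arXiv:0806.3193) with the proof of Cor. 1 (p. 5)]
[cite: Oba2016, Thm. 1.3] -/
def Wendl2010_planarStein_palf : Prop :=
  ∀ (W : Type) [TopologicalSpace W] [T2Space W] [SecondCountableTopology W]
    [ChartedSpace (EuclideanHalfSpace 4) W] [IsManifold (𝓡∂ 4) ∞ W] [CompactSpace W]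
    [ConnectedSpace W] (S : SteinStructure W) (b : BoundaryData (𝓡∂ 4) W (𝓡 3))
    (K : OpenBook b.carrier), K.IsPlanar → K.Supports (boundaryPlaneField S.J b) →
    ∃ P : PALF S.complexOrientation b, P.ob.IsPlanar ∧ Nonempty (P.ob.binding ≃ₜ K.binding)

end Literature.Geometry.Symplectic

end
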